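import Summits.ValiantsHypothesis.ValiantsHypothesis.Theorems.FifoMatchingNNDivisionHardLocatedRowsTemplateCeiling
import HarnessLib

/-!
# LOCATED ROWS — part 10 — §5d ★★ the COORDINATE-FACE CEILING for ANY private symmetric generator of sign-indefinite clique weight

Theorems-side port (staged by val-idea-40 g5; press as `Theorems/FifoMatchingNNDivisionHardLocatedRowsPrivateCeiling.lean`,
`--kind proof --supports stmt-ValiantsHypothesis-21181 --as helper`) of §5d of the crux workfile `Cruxes/NNDivisionHard/LocatedRows.lean`
REV 8 @e7969df5de15 (critic of record val-idea-crit-9 g2: §5d booked as instrument with §5c, row 93).  Imports the landed part 8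
`…LocatedRowsTemplateCeiling` (✓ p682277) and hence parts 1–7.

* `coordTight_dot_private` — FULL coordinate-face tightness over `U` makes a tilt blind to every symmetric matrix supported
  off-diagonally in `U × U` (mixed second differences on every pair of `U`);
* ★★ `no_pure_block_of_private` — no pure coordinate-face exact-tilted located block (any tilt per row, any passenger index per
  column, any row bounds) on a cube containing a symmetric generator `g` supported off-diagonally in `U × U` with
  `⟨udRow a₁, g⟩ > 0 > ⟨udRow a₂, g⟩` for two block rows; `no_pure_block_of_zgen` (part 8) is the instance `g = zgen k l m`.

HONEST LABEL: a CEILING of a certificate TEMPLATE (coordinate faces), not a rank₊ bound and not a refutation of C′; 21181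
`NNDivisionHard`, `ExactPencilLaw` (C′), `allRows.Law`, COR-VIRTUAL are OPEN.  VP ≠ VNP is NOT proved here or anywhere in this tree.
-/

set_option autoImplicit false

-- the mandated summit-side namespace repeats a component by design (single-problem summit)
set_option linter.dupNamespace false

noncomputable section

open Matrix Finset
open scoped Pointwise

namespace Summit.ValiantsHypothesis.ValiantsHypothesis.Theorems.FifoMatching.LocatedRows

open Literature.Barriers.PneNP (HasEFOfSize three_pow_le_card_mul_two_pow_of_cover_univ)
open Literature.Combinatorics.Optimization.FixedSizePsdRank (Cube bvec flat vecOuter corPolytope flat_dotProduct_vecOuter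
  flat_dotProduct_le_of_mem_corPolytope)
open Summit.ValiantsHypothesis.ValiantsHypothesis.Theorems.FifoMatching.XcDivision
  (udInd udPt udRow udMat udInd_apply udInd_sq udInd_inter ud_data udRow_dotProduct_flat_diagonal flat_dotProduct_flat
    dot_le_of_mem_convexHull)
open Summit.ValiantsHypothesis.Theorems.NNDivisionHardNegative.CliqueRowBlind (sum_udInd_mem sum_udInd_univ)
open Summit.ValiantsHypothesis.ValiantsHypothesis.Theorems.FifoMatching.GridCorShadow (four_T_lt_two_pow)
open Summit.ValiantsHypothesis.Theorems.NNDivisionHardNegative.DiagTilted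
  (qOff qOffMat qOff_eq hasEFOfSize_qOff udRow_dotProduct_qOff udInd_compl udInd_univ)

section PrivateCeiling
variable {n : ℕ}


/-! ## §5d ★★ The coordinate-face ceiling for ANY private symmetric generator (covers 38 g2's enemy candidate `Q_II`)

`no_pure_block_of_zgen` used of the generator only two things: it is ZERO-DIAGONAL SYMMETRIC-IN-EFFECT and supported in `U × U`
(so every tilt tight on the coordinate face `{S ∪ b : b ⊆ U}` is blind to it — full tightness kills the symmetrised `U × U`
entries), and its CLIQUE WEIGHT IS SIGN-INDEFINITE across block rows (`+2` on `{k,m}`, `−2` on `{k,l}`).  The general statement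
(`no_pure_block_of_private`): for ANY symmetric `g` with `g p q ≠ 0 ⇒ p, q ∈ U, p ≠ q` occurring among the generators and ANY two
block rows `a₁, a₂ ⊆ U` with `⟨udRow a₁, g⟩ > 0 > ⟨udRow a₂, g⟩`, no exact-tilted located block at a coordinate face over `U` is pure.
Instance: 38 g2's interaction differences `I_{u,v} − I_{u,v'}` (§10 `udRow_map_dotProduct_interDiff = ∓2`), i.e. the enemy
candidate `Q_II` has no coordinate-face pure-block certificate either (38 §10 excludes the transversal face). -/

/-- (i″) FULL coordinate-face tightness over `U` makes a tilt blind to every symmetric matrix supported off-diagonally in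
`U × U`. -/
theorem coordTight_dot_private (W g : Matrix (Fin n) (Fin n) ℝ) (S U : Finset (Fin n)) (hSU : Disjoint S U)
    (hT : ∀ b, b ⊆ U → flat W ⬝ᵥ udPt (S ∪ b) = flat W ⬝ᵥ udPt S)
    (hgsym : ∀ p q, g p q = g q p) (hgU : ∀ p q, g p q ≠ 0 → p ∈ U ∧ q ∈ U ∧ p ≠ q) :
    flat W ⬝ᵥ flat g = 0 := by
  classical
  have notS : ∀ {x : Fin n}, x ∈ U → x ∉ S := fun hx h => Finset.disjoint_left.1 hSU h hx
  have pairU : ∀ {x y : Fin n}, x ∈ U → y ∈ U → ({x, y} : Finset (Fin n)) ⊆ U := fun hx hy =>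
    Finset.insert_subset_iff.2 ⟨hx, Finset.singleton_subset_iff.2 hy⟩
  have singU : ∀ {x : Fin n}, x ∈ U → ({x} : Finset (Fin n)) ⊆ U := fun hx => Finset.singleton_subset_iff.2 hx
  have hS1 : ∀ x : Fin n, S ∪ {x} = insert x S := fun x => by
    ext y; simp only [Finset.mem_union, Finset.mem_singleton, Finset.mem_insert]; tauto
  have hS2 : ∀ x y : Fin n, S ∪ {x, y} = insert x (insert y S) := fun x y => by
    ext z; simp only [Finset.mem_union, Finset.mem_singleton, Finset.mem_insert]; tauto
  have hval : ∀ b, b ⊆ U → ∑ p ∈ S ∪ b, ∑ q ∈ S ∪ b, W p q = ∑ p ∈ S, ∑ q ∈ S, W p q := fun b hb => by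
    rw [← flat_dotProduct_udPt_eq, ← flat_dotProduct_udPt_eq]; exact hT b hb
  have hsym : ∀ k l, k ∈ U → l ∈ U → k ≠ l → W k l + W l k = 0 := by
    intro k l hk hl hkl
    have h := mixed_diff W (notS hk) (notS hl) hkl
    rw [← hS2 k l, ← hS1 k, ← hS1 l, hval _ (pairU hk hl), hval _ (singU hk), hval _ (singU hl)] at h
    linarith
  have hterm : ∀ i j, W i j * g i j + W j i * g j i = 0 := by
    intro i j
    by_cases hg : g i j = 0
    · have hg' : g j i = 0 := by rw [← hgsym i j]; exact hg
      rw [hg, hg', mul_zero, mul_zero, add_zero]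
    · obtain ⟨hi, hj, hij⟩ := hgU i j hg
      rw [← hgsym i j, ← add_mul, hsym i j hi hj hij, zero_mul]
  have htot : ∑ i, ∑ j, (W i j * g i j + W j i * g j i) = 0 :=
    Finset.sum_eq_zero fun i _ => Finset.sum_eq_zero fun j _ => hterm i j
  have hB : ∑ i, ∑ j, W j i * g j i = ∑ i, ∑ j, W i j * g i j := Finset.sum_comm
  simp only [Finset.sum_add_distrib] at htot
  rw [hB] at htot
  rw [flat_dotProduct_flat]
  linarith

/-- ★★ **NO PURE COORDINATE-FACE LOCATED BLOCK ON A CUBE WITH A PRIVATE SYMMETRIC GENERATOR OF SIGN-INDEFINITE CLIQUE WEIGHT —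
for ANY exact-tilted rows.**  As `no_pure_block_of_zgen`, with the generator `zgen k l m` replaced by any symmetric `g` supported
off-diagonally in `U × U` and two block rows `a₁, a₂ ⊆ U` on which `udRow` weighs `g` with opposite strict signs. -/
theorem no_pure_block_of_private {N K : ℕ} (Q₀ : Matrix (Fin n) (Fin n) ℝ) (G : Fin N → Matrix (Fin n) (Fin n) ℝ)
    (e : Fin (K + 1) → Finset (Fin N)) (he : Function.Surjective e) (S U : Finset (Fin n)) (hSU : Disjoint S U)
    {t : Fin N} (g : Matrix (Fin n) (Fin n) ℝ) (hG : G t = g)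
    (hgsym : ∀ p q, g p q = g q p) (hgU : ∀ p q, g p q ≠ 0 → p ∈ U ∧ q ∈ U ∧ p ≠ q)
    {a₁ a₂ : Finset (Fin n)} (ha₁ : a₁ ⊆ U) (ha₂ : a₂ ⊆ U)
    (hpos : 0 < udRow a₁ ⬝ᵥ flat g) (hneg : udRow a₂ ⬝ᵥ flat g < 0)
    (W : Finset (Fin n) → Matrix (Fin n) (Fin n) ℝ) (jc : Finset (Fin n) → Fin (K + 1)) (mrow : Finset (Fin n) → ℝ)
    (hmq : ∀ a j, (udRow a + flat (W a)) ⬝ᵥ cubePt Q₀ G (e j) ≤ mrow a) :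
    ¬ ∀ a, a ⊆ U → ∀ b, b ⊆ U →
        (1 + hCOR (W a) + mrow a) - (udRow a + flat (W a)) ⬝ᵥ (udPt (S ∪ b) + cubePt Q₀ G (e (jc b)))
          = (1 - ((a ∩ b).card : ℝ)) ^ 2 := by
  classical
  intro hblock
  obtain ⟨-, -, slack, -⟩ := ud_data n
  have notS : ∀ {x : Fin n}, x ∈ U → x ∉ S := fun hx h => Finset.disjoint_left.1 hSU h hx
  have hdec : ∀ a, a ⊆ U → ∀ b, b ⊆ U →
      flat (W a) ⬝ᵥ udPt (S ∪ b) = hCOR (W a) ∧ (udRow a + flat (W a)) ⬝ᵥ cubePt Q₀ G (e (jc b)) = mrow a := by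
    intro a ha b hb
    have h := hblock a ha b hb
    have hab : a ∩ (S ∪ b) = a ∩ b := by
      ext x
      simp only [Finset.mem_inter, Finset.mem_union]
      constructor
      · rintro ⟨hx, hx' | hx'⟩
        · exact absurd hx' (notS (ha hx))
        · exact ⟨hx, hx'⟩
      · rintro ⟨hx, hx'⟩
        exact ⟨hx, Or.inr hx'⟩
    have hs := slack a (S ∪ b)
    rw [hab] at hs
    have hA := le_hCOR (W a) (S ∪ b)
    have hJ := hmq a (jc b)
    rw [dotProduct_add, add_dotProduct (udRow a) (flat (W a)) (udPt (S ∪ b))] at h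
    constructor <;> linarith
  have horth : ∀ a, a ⊆ U → flat (W a) ⬝ᵥ flat (G t) = 0 := by
    intro a ha
    have h0 := (hdec a ha ∅ (Finset.empty_subset _)).1
    rw [Finset.union_empty] at h0
    rw [hG]
    exact coordTight_dot_private (W a) g S U hSU (fun b hb => by rw [(hdec a ha b hb).1, h0]) hgsym hgU
  have hrow : ∀ a, a ⊆ U → (udRow a + flat (W a)) ⬝ᵥ flat (G t) = udRow a ⬝ᵥ flat g := fun a ha => by
    rw [add_dotProduct, horth a ha, add_zero, hG]
  have hval : ∀ (ρ : Fin (n * n) → ℝ) (P : Finset (Fin N)), t ∉ P →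
      ρ ⬝ᵥ cubePt Q₀ G (insert t P) = ρ ⬝ᵥ cubePt Q₀ G P + ρ ⬝ᵥ flat (G t) := fun ρ P ht => by
    rw [dotProduct_cubePt, dotProduct_cubePt, Finset.sum_insert ht]
    ring
  have hmaxat : ∀ a, a ⊆ U → (udRow a + flat (W a)) ⬝ᵥ cubePt Q₀ G (e (jc ∅)) = mrow a :=
    fun a ha => (hdec a ha ∅ (Finset.empty_subset _)).2
  by_cases ht : t ∈ e (jc ∅)
  · obtain ⟨j', hj'⟩ := he ((e (jc ∅)).erase t)
    have h1 := hmq a₂ j'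
    rw [hj'] at h1
    have h2 := hval (udRow a₂ + flat (W a₂)) ((e (jc ∅)).erase t) (Finset.notMem_erase t _)
    rw [Finset.insert_erase ht, hrow _ ha₂, hmaxat _ ha₂] at h2
    linarith
  · obtain ⟨j', hj'⟩ := he (insert t (e (jc ∅)))
    have h1 := hmq a₁ j'
    rw [hj'] at h1
    have h2 := hval (udRow a₁ + flat (W a₁)) (e (jc ∅)) ht
    rw [hrow _ ha₁, hmaxat _ ha₁] at h2
    linarith

end PrivateCeiling

end Summit.ValiantsHypothesis.ValiantsHypothesis.Theorems.FifoMatching.LocatedRows
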